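import Summits.HodgeConjecture.CorCM.IrreducibleOddWeightsCanonicalPivotBound
import HarnessLib

/-!
# Core tower, I: the canonical pivot is ABSORBING — `MC₀ ∩ MC₁ = F₀^W ∩ F₁^W` propagates along a tower of ever
# coarser orbit partitions (abstract `G`-sets)

COR-CM (cell `pub-hodgecm2`, binder seat `b16` gen 67, count-neutral claim CORE TOWER, file A1 — abstract `G`-set
level; theorems only, no definition, no named fact, no `sorry`).  NEW as stated, hence under `Summits/`.  HONEST
FRAMING: finite-dimensional linear algebra about the Kubota–Dodson rank of a pair of CM types (`dim Hg(A₀ × A₁)` versus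
`dim Hg(A₀) + dim Hg(A₁)` for abelian varieties with complex multiplication); `HC_CM` is neither used nor asserted.

SETTING (gen 64 R1/R3 `IrreducibleOddWeightsRightIdeals{,Pivot}`, gen 65 C1 `IrreducibleOddWeightsCanonicalPivot`).  A
group `G` acts on finite slots `E_i` (`G = Aut(ℂ)`, `E_i = Hom(K_i, ℂ)`); types `Φ_i ⊆ E_i`, type vectors
`u_i = 2·𝟙_{Φ_i} − 1`; MATRIX-COEFFICIENT SPACES `MC_i = span{g ↦ u_i(g·x) : x ∈ E_i} ≤ ℚ^G`; R1: `dim Hg(A₀) + dim Hg(A₁)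
− dim Hg(A₀ × A₁) = dim(MC₀ ∩ MC₁)`.  For an auxiliary `G`-set `W` write `S_W = {n | n·y = y ∀ y ∈ W}` (a NORMAL subgroup:
the pointwise stabiliser; `S_{E₁} = PW₁`) and `F_i^W = span{ g ↦ Σ_{x ∈ S_W·x₀} u_i(g·x) : x₀ ∈ E_i }` (matrix coefficients
SUMMED OVER THE `S_W`-ORBITS).  C1 proved `MC₀ ∩ MC₁ = F₀^{E₁} ∩ F₁^{E₀}` and stopped.  THIS FILE shows that the pivot is
ABSORBING and can be ITERATED:
* §1 One slot.  `F^W ≤ MC` (`span_stabOrbitSum_le_span_coeff`), `F^X = MC` (`span_stabOrbitSum_self_eq_span_coeff`).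
  **MOVERS PRESERVE ORBIT SUMS** (`stabOrbit_sum_antiVec_mul_eq_of_movers`, `apply_mul_eq_of_mem_span_stabOrbitSum`): if
  `m ∈ G` moves every point of `X` inside its `S_W`-orbit (`m·x ∈ S_W·x ∀ x`), then every element of `F^W` is
  right-`m`-invariant (`c(gm) = c(g)`) — `x ↦ m·x` permutes each orbit, `S_W` being normal.  **AVERAGING, `W`-form**
  (`mem_span_stabOrbitSum_of_forall_apply_mul_eq`): an element of `MC` right-invariant under `S_{W'}` lies in `F^{W'}`
  (gen 64's averaging lemma on the orbit map).  VANISHING (`span_stabOrbitSum_eq_bot_of_stabOrbit_rho_stable`): `F^W = 0` when every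
  `S_W`-orbit is stable under the conjugation `ρ`.
* §2 Two slots.  **THE ABSORPTION STEP** (`span_stabOrbitSum_inf_span_coeff_le_of_movers`): if `S_{W'}` moves every point
  of `E₀` inside its `S_W`-orbit then **`F₀^W ∩ MC₁ ≤ F₀^{W'} ∩ F₁^{W'}`**; hence (`span_coeff_inf_eq_of_absorbed_of_movers{,'}`)
  if `MC₀ ∩ MC₁ = F₀^W ∩ F₁^W` («`W` is absorbed») then `MC₀ ∩ MC₁ = F₀^{W'} ∩ F₁^{W'}` («`W'` is absorbed») for every `W'`
  whose pointwise stabiliser moves the points of ONE of the slots inside their `S_W`-orbits.  BASE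
  (`span_coeff_inf_eq_span_stabOrbitSum_self_inf`): `W = E₀` is absorbed (this is C1).  So along any tower
  `E₀ = W⁰, W¹, W², …`, each `S_{W^{k+1}}` moving the points of a slot inside their `S_{W^k}`-orbits, EVERY `W^k` computes
  the defect of EVERY type pair exactly, in ever coarser orbits (for `Aut(ℂ)`: the Galois closures of the traces of the
  traces…, file A2 `IrreducibleOddWeightsCoreTowerCMFields`).
* §3 On an absorbed level: the exact defect (`typeRank_add_typeRank_eq_add_finrank_of_absorbed`), additivity iff
  `F₀^W ∩ F₁^W = 0`, one-sided vanishing, and the TYPE-FREE two- and three-step criteria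
  (`typeRank_sigmaType_add_card_eq_of_movers_of_rho_stable`, `…_of_movers_of_movers_of_rho_stable`): if `S_{W¹}` moves the
  points of `E₁` inside their `PW₀`-orbits and every `S_{W¹}`-orbit on `E₀` is `ρ`-stable, then
  `Hg(A₀ × A₁) = Hg(A₀) × Hg(A₁)` for ALL CM types — C1's one-step criterion asked the `PW₁`-orbits on `E₀` themselves to
  be `ρ`-stable.

## References

* [Gordon1999HodgeAVSurvey] B. B. Gordon, *A survey of the Hodge conjecture for abelian varieties*, §3 Theorem (Imai,
  Murty) with proof, 7.5–7.7, 9.4.3.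
* [Deligne1982HodgeCycles] P. Deligne, *Hodge cycles on abelian varieties*, LNM 900 (1982), I.5 (p. 62).
* [Serre1977] J.-P. Serre, *Linear Representations of Finite Groups*, GTM 42, §3.3, §7 Ex. 7.2.
* [Shimura1998] G. Shimura, *Abelian Varieties with Complex Multiplication and Modular Functions*, §8.1, §8.3, §18.1.
-/

set_option autoImplicit false

noncomputable section

open scoped BigOperators Classical

universe u v w
namespace Summit.HodgeConjecture.CorCM.IrrOdd

open Literature.NumberTheory.ComplexMultiplication

variable {G : Type w} [Group G]

/-! ### §1 One slot: orbit sums of a pointwise stabiliser, movers, averaging, vanishing -/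

section OneSlot

variable {X : Type v} [MulAction G X] [Fintype X] {W : Type*} [MulAction G W]

/-- **`F^W ≤ MC`**: orbit sums of matrix coefficients are matrix coefficients. [cite: Gordon1999HodgeAVSurvey, §3 Theorem (proof)] -/
theorem span_stabOrbitSum_le_span_coeff (Φ : Set X) :
    Submodule.span ℚ (Set.range fun x₀ : X => fun g : G =>
        ∑ x ∈ Finset.univ.filter (fun x : X => ∃ n : G, (∀ y : W, n • y = y) ∧ n • x₀ = x), antiVec Φ g x) ≤
      Submodule.span ℚ (Set.range fun x : X => fun g : G => antiVec Φ g x) := by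
  rw [Submodule.span_le]
  rintro _ ⟨x₀, rfl⟩
  exact sum_coeff_mem_span_coeff Φ _

/-- **`F^X = MC`**: the pointwise stabiliser of the slot itself has singleton orbits on it, so its orbit sums are the
matrix coefficients (the BASE of the tower). [cite: Serre1977, §7 Ex. 7.2] -/
theorem span_stabOrbitSum_self_eq_span_coeff (Φ : Set X) :
    Submodule.span ℚ (Set.range fun x₀ : X => fun g : G =>
        ∑ x ∈ Finset.univ.filter (fun x : X => ∃ n : G, (∀ y : X, n • y = y) ∧ n • x₀ = x), antiVec Φ g x) =
      Submodule.span ℚ (Set.range fun x : X => fun g : G => antiVec Φ g x) := by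
  have e : (fun x₀ : X => fun g : G =>
      ∑ x ∈ Finset.univ.filter (fun x : X => ∃ n : G, (∀ y : X, n • y = y) ∧ n • x₀ = x), antiVec Φ g x) =
        fun x₀ : X => fun g : G => antiVec Φ g x₀ := by
    funext x₀ g
    have hfilter : Finset.univ.filter (fun x : X => ∃ n : G, (∀ y : X, n • y = y) ∧ n • x₀ = x) = {x₀} := by
      ext x
      simp only [Finset.mem_filter, Finset.mem_univ, true_and, Finset.mem_singleton]
      constructor
      · rintro ⟨n, hn, rfl⟩
        exact hn x₀
      · rintro rfl
        exact ⟨1, fun y => one_smul G y, one_smul G _⟩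
    rw [hfilter, Finset.sum_singleton]
  rw [e]

/-- **MOVERS PRESERVE ORBIT SUMS.**  If `m` moves every point of `X` inside its `S_W`-orbit (`m·x = n_x·x` with `n_x`
fixing `W` pointwise), then `x ↦ m·x` permutes each `S_W`-orbit (`S_W` is normal: `m·(n·x₀) = (mnm⁻¹)·(m·x₀)`), so the
orbit sum of the translate `u_{gm}` equals that of `u_g`: `Σ_{x ∈ S_W·x₀} u(gm·x) = Σ_{x ∈ S_W·x₀} u(g·x)`.
[cite: Serre1977, §3.3 and §7 Ex. 7.2] -/
theorem stabOrbit_sum_antiVec_mul_eq_of_movers (Φ : Set X) {m : G}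
    (hm : ∀ x : X, ∃ n : G, (∀ y : W, n • y = y) ∧ n • x = m • x) (g : G) (x₀ : X) :
    ∑ x ∈ Finset.univ.filter (fun x : X => ∃ n : G, (∀ y : W, n • y = y) ∧ n • x₀ = x), antiVec Φ (g * m) x =
      ∑ x ∈ Finset.univ.filter (fun x : X => ∃ n : G, (∀ y : W, n • y = y) ∧ n • x₀ = x), antiVec Φ g x := by
  simp only [antiVec_mul_apply]
  refine Finset.sum_nbij' (fun x => m • x) (fun x => m⁻¹ • x) ?_ ?_ ?_ ?_ ?_
  · intro x hx
    simp only [Finset.mem_filter, Finset.mem_univ, true_and] at hx ⊢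
    obtain ⟨n, hn, rfl⟩ := hx
    obtain ⟨n', hn', hn'x⟩ := hm x₀
    refine ⟨m * n * m⁻¹ * n', fun y => ?_, ?_⟩
    · rw [mul_smul, mul_smul, mul_smul, hn' y, hn (m⁻¹ • y), smul_inv_smul]
    · rw [mul_smul, mul_smul, mul_smul, hn'x, inv_smul_smul]
  · intro x hx
    simp only [Finset.mem_filter, Finset.mem_univ, true_and] at hx ⊢
    obtain ⟨n, hn, rfl⟩ := hx
    obtain ⟨n'', hn'', h''⟩ := hm (m⁻¹ • n • x₀)
    rw [smul_inv_smul] at h''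
    refine ⟨n''⁻¹ * n, fun y => ?_, ?_⟩
    · rw [mul_smul, inv_smul_eq_iff, hn'' y, hn y]
    · rw [mul_smul]
      exact (eq_inv_smul_iff.2 h'').symm
  · exact fun x _ => inv_smul_smul m x
  · exact fun x _ => smul_inv_smul m x
  · exact fun x _ => rfl

/-- **Every element of `F^W` is right-invariant under the movers**: `c(gm) = c(g)` for `c ∈ F^W` and every `m` moving
the points of `X` inside their `S_W`-orbits (in particular for `m ∈ S_W`, and for every `m` fixing pointwise a `G`-set
`W'` whose pointwise stabiliser has coarser orbits). [cite: Serre1977, §3.3] -/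
theorem apply_mul_eq_of_mem_span_stabOrbitSum (Φ : Set X) {c : G → ℚ}
    (hc : c ∈ Submodule.span ℚ (Set.range fun x₀ : X => fun g : G =>
        ∑ x ∈ Finset.univ.filter (fun x : X => ∃ n : G, (∀ y : W, n • y = y) ∧ n • x₀ = x), antiVec Φ g x))
    {m : G} (hm : ∀ x : X, ∃ n : G, (∀ y : W, n • y = y) ∧ n • x = m • x) (g : G) : c (g * m) = c g := by
  induction hc using Submodule.span_induction with
  | mem _ hx =>
    obtain ⟨x₀, rfl⟩ := hx
    exact stabOrbit_sum_antiVec_mul_eq_of_movers Φ hm g x₀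
  | zero => rfl
  | add _ _ _ _ h₁ h₂ => simp only [Pi.add_apply, h₁, h₂]
  | smul a _ _ h₁ => simp only [Pi.smul_apply, h₁]

/-- **AVERAGING, `W'`-form.**  An element of `MC` which is right-invariant under the pointwise stabiliser `S_{W'}` of a
`G`-set `W'` lies in `F^{W'}` (gen 64's averaging lemma for the orbit map of `S_{W'}`, on whose fibres `S_{W'}` is
transitive). [cite: Serre1977, §3.3] [cite: Gordon1999HodgeAVSurvey, §3 Theorem (proof)] -/
theorem mem_span_stabOrbitSum_of_forall_apply_mul_eq (Φ : Set X) {W' : Type*} [MulAction G W'] {c : G → ℚ}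
    (hc : c ∈ Submodule.span ℚ (Set.range fun x : X => fun g : G => antiVec Φ g x))
    (hinv : ∀ m : G, (∀ y : W', m • y = y) → ∀ g : G, c (g * m) = c g) :
    c ∈ Submodule.span ℚ (Set.range fun x₀ : X => fun g : G =>
        ∑ x ∈ Finset.univ.filter (fun x : X => ∃ n : G, (∀ y : W', n • y = y) ∧ n • x₀ = x), antiVec Φ g x) := by
  have h := mem_span_fibreSum_of_forall_apply_mul_eq Φ
    (fun x : X => MulAction.orbit (MulAction.toPermHom G W').ker x) (MulAction.toPermHom G W').ker
    (fun x x' hxx' => exists_smul_eq_of_orbit_eq (MulAction.toPermHom G W').ker hxx') hc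
    (fun n hn g => hinv n ((mem_ker_toPermHom_iff n).1 hn) g)
  rw [span_fibreSum_eq_span_fibreSum_apply Φ
      (fun x : X => MulAction.orbit (MulAction.toPermHom G W').ker x)] at h
  have e : ∀ x₀ : X, Finset.univ.filter (fun x : X =>
      MulAction.orbit (MulAction.toPermHom G W').ker x = MulAction.orbit (MulAction.toPermHom G W').ker x₀) =
        Finset.univ.filter (fun x : X => ∃ n : G, (∀ y : W', n • y = y) ∧ n • x₀ = x) := fun x₀ => by
    rw [filter_orbit_eq_eq_filter_exists_smul]
    exact Finset.filter_congr fun x _ => by simp only [mem_ker_toPermHom_iff]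
  simp only [e] at h
  exact h

/-- **VANISHING: `F^W = 0` when every `S_W`-orbit on `X` is `ρ`-stable** (`ρ` a conjugation for which `Φ` is a CM type):
the translates of an orbit sum are orbit sums of the base vector (`S_W` is normal), and a `ρ`-odd vector sums to zero
over a `ρ`-stable orbit. [cite: Shimura1998, §18.1 and §8.3] [cite: Gordon1999HodgeAVSurvey, §3 Theorem (proof)] -/
theorem span_stabOrbitSum_eq_bot_of_stabOrbit_rho_stable {ρ : G} {Φ : Set X} (h : IsCMTypeWith ρ Φ)
    (hρ : ∀ x₀ : X, ∃ n : G, (∀ y : W, n • y = y) ∧ n • x₀ = ρ • x₀) :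
    Submodule.span ℚ (Set.range fun x₀ : X => fun g : G =>
        ∑ x ∈ Finset.univ.filter (fun x : X => ∃ n : G, (∀ y : W, n • y = y) ∧ n • x₀ = x), antiVec Φ g x) =
      (⊥ : Submodule ℚ (G → ℚ)) := by
  rw [Submodule.span_eq_bot]
  rintro _ ⟨x₀, rfl⟩
  funext g
  dsimp only
  rw [stabOrbit_sum_antiVec_eq (W := W) Φ g x₀,
    stabOrbit_sum_antiVec_eq_zero_of_rho_mem (W := W) h (g • x₀) (hρ (g • x₀)), Pi.zero_apply]

end OneSlot

/-! ### §2 Two slots: the absorption step and the base of the tower -/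

section TwoSlots

variable {I : Type u} {E : I → Type v} [∀ i, MulAction G (E i)] [∀ i, Fintype (E i)]
  {W : Type*} [MulAction G W] {W' : Type*} [MulAction G W']

/-- **THE ABSORPTION STEP: `F₀^W ∩ MC₁ ≤ F₀^{W'} ∩ F₁^{W'}`** whenever the pointwise stabiliser `S_{W'}` moves every
point of `E₀` inside its `S_W`-orbit.  (An element of `F₀^W` is right-`S_{W'}`-invariant by §1; being in `MC₀` and in
`MC₁`, averaging puts it in `F₀^{W'}` and in `F₁^{W'}`.)  No hypothesis on the group, the slots or the types.
[cite: Gordon1999HodgeAVSurvey, §3 Theorem (proof)] [cite: Serre1977, §3.3] -/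
theorem span_stabOrbitSum_inf_span_coeff_le_of_movers (Φ : ∀ i, Set (E i)) (i₀ i₁ : I)
    (hW' : ∀ m : G, (∀ y' : W', m • y' = y') → ∀ x : E i₀, ∃ n : G, (∀ y : W, n • y = y) ∧ n • x = m • x) :
    Submodule.span ℚ (Set.range fun x₀ : E i₀ => fun g : G =>
          ∑ x ∈ Finset.univ.filter (fun x : E i₀ => ∃ n : G, (∀ y : W, n • y = y) ∧ n • x₀ = x),
            antiVec (Φ i₀) g x) ⊓
        Submodule.span ℚ (Set.range fun x : E i₁ => fun g : G => antiVec (Φ i₁) g x) ≤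
      Submodule.span ℚ (Set.range fun x₀ : E i₀ => fun g : G =>
          ∑ x ∈ Finset.univ.filter (fun x : E i₀ => ∃ n : G, (∀ y : W', n • y = y) ∧ n • x₀ = x),
            antiVec (Φ i₀) g x) ⊓
        Submodule.span ℚ (Set.range fun x₁ : E i₁ => fun g : G =>
          ∑ x ∈ Finset.univ.filter (fun x : E i₁ => ∃ n : G, (∀ y : W', n • y = y) ∧ n • x₁ = x),
            antiVec (Φ i₁) g x) := by
  rintro c ⟨hc₀, hc₁⟩
  have hinv : ∀ m : G, (∀ y' : W', m • y' = y') → ∀ g : G, c (g * m) = c g := fun m hm g =>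
    apply_mul_eq_of_mem_span_stabOrbitSum (Φ i₀) hc₀ (hW' m hm) g
  exact ⟨mem_span_stabOrbitSum_of_forall_apply_mul_eq (Φ i₀) (span_stabOrbitSum_le_span_coeff (Φ i₀) hc₀) hinv,
    mem_span_stabOrbitSum_of_forall_apply_mul_eq (Φ i₁) hc₁ hinv⟩

/-- **ABSORPTION PROPAGATES (slot `0` driving): if `MC₀ ∩ MC₁ = F₀^W ∩ F₁^W` and `S_{W'}` moves every point of `E₀`
inside its `S_W`-orbit, then `MC₀ ∩ MC₁ = F₀^{W'} ∩ F₁^{W'}`** — the next, coarser level of the tower computes the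
common matrix coefficients exactly as well. [cite: Gordon1999HodgeAVSurvey, §3 Theorem (proof)] [cite: Serre1977, §3.3] -/
theorem span_coeff_inf_eq_of_absorbed_of_movers (Φ : ∀ i, Set (E i)) (i₀ i₁ : I)
    (habs : Submodule.span ℚ (Set.range fun x : E i₀ => fun g : G => antiVec (Φ i₀) g x) ⊓
        Submodule.span ℚ (Set.range fun x : E i₁ => fun g : G => antiVec (Φ i₁) g x) ≤
      Submodule.span ℚ (Set.range fun x₀ : E i₀ => fun g : G =>
          ∑ x ∈ Finset.univ.filter (fun x : E i₀ => ∃ n : G, (∀ y : W, n • y = y) ∧ n • x₀ = x),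
            antiVec (Φ i₀) g x) ⊓
        Submodule.span ℚ (Set.range fun x₁ : E i₁ => fun g : G =>
          ∑ x ∈ Finset.univ.filter (fun x : E i₁ => ∃ n : G, (∀ y : W, n • y = y) ∧ n • x₁ = x),
            antiVec (Φ i₁) g x))
    (hW' : ∀ m : G, (∀ y' : W', m • y' = y') → ∀ x : E i₀, ∃ n : G, (∀ y : W, n • y = y) ∧ n • x = m • x) :
    Submodule.span ℚ (Set.range fun x : E i₀ => fun g : G => antiVec (Φ i₀) g x) ⊓
        Submodule.span ℚ (Set.range fun x : E i₁ => fun g : G => antiVec (Φ i₁) g x) =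
      Submodule.span ℚ (Set.range fun x₀ : E i₀ => fun g : G =>
          ∑ x ∈ Finset.univ.filter (fun x : E i₀ => ∃ n : G, (∀ y : W', n • y = y) ∧ n • x₀ = x),
            antiVec (Φ i₀) g x) ⊓
        Submodule.span ℚ (Set.range fun x₁ : E i₁ => fun g : G =>
          ∑ x ∈ Finset.univ.filter (fun x : E i₁ => ∃ n : G, (∀ y : W', n • y = y) ∧ n • x₁ = x),
            antiVec (Φ i₁) g x) := by
  refine le_antisymm (fun c hc => ?_)
    (inf_le_inf (span_stabOrbitSum_le_span_coeff (Φ i₀)) (span_stabOrbitSum_le_span_coeff (Φ i₁)))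
  exact span_stabOrbitSum_inf_span_coeff_le_of_movers Φ i₀ i₁ hW' ⟨(habs hc).1, hc.2⟩

/-- **ABSORPTION PROPAGATES (slot `1` driving)**: the same with `S_{W'}` moving every point of `E₁` inside its
`S_W`-orbit. [cite: Gordon1999HodgeAVSurvey, §3 Theorem (proof)] [cite: Serre1977, §3.3] -/
theorem span_coeff_inf_eq_of_absorbed_of_movers' (Φ : ∀ i, Set (E i)) (i₀ i₁ : I)
    (habs : Submodule.span ℚ (Set.range fun x : E i₀ => fun g : G => antiVec (Φ i₀) g x) ⊓
        Submodule.span ℚ (Set.range fun x : E i₁ => fun g : G => antiVec (Φ i₁) g x) ≤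
      Submodule.span ℚ (Set.range fun x₀ : E i₀ => fun g : G =>
          ∑ x ∈ Finset.univ.filter (fun x : E i₀ => ∃ n : G, (∀ y : W, n • y = y) ∧ n • x₀ = x),
            antiVec (Φ i₀) g x) ⊓
        Submodule.span ℚ (Set.range fun x₁ : E i₁ => fun g : G =>
          ∑ x ∈ Finset.univ.filter (fun x : E i₁ => ∃ n : G, (∀ y : W, n • y = y) ∧ n • x₁ = x),
            antiVec (Φ i₁) g x))
    (hW' : ∀ m : G, (∀ y' : W', m • y' = y') → ∀ x : E i₁, ∃ n : G, (∀ y : W, n • y = y) ∧ n • x = m • x) :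
    Submodule.span ℚ (Set.range fun x : E i₀ => fun g : G => antiVec (Φ i₀) g x) ⊓
        Submodule.span ℚ (Set.range fun x : E i₁ => fun g : G => antiVec (Φ i₁) g x) =
      Submodule.span ℚ (Set.range fun x₀ : E i₀ => fun g : G =>
          ∑ x ∈ Finset.univ.filter (fun x : E i₀ => ∃ n : G, (∀ y : W', n • y = y) ∧ n • x₀ = x),
            antiVec (Φ i₀) g x) ⊓
        Submodule.span ℚ (Set.range fun x₁ : E i₁ => fun g : G =>
          ∑ x ∈ Finset.univ.filter (fun x : E i₁ => ∃ n : G, (∀ y : W', n • y = y) ∧ n • x₁ = x),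
            antiVec (Φ i₁) g x) := by
  refine le_antisymm (fun c hc => ?_)
    (inf_le_inf (span_stabOrbitSum_le_span_coeff (Φ i₀)) (span_stabOrbitSum_le_span_coeff (Φ i₁)))
  have h := span_stabOrbitSum_inf_span_coeff_le_of_movers Φ i₁ i₀ hW' ⟨(habs hc).2, hc.1⟩
  exact ⟨h.2, h.1⟩

/-- **THE BASE OF THE TOWER: `MC₀ ∩ MC₁ = F₀^{E₀} ∩ F₁^{E₀}`** (`W = E₀` is absorbed): `S_{E₀} = PW₀` has singleton
orbits on `E₀` (`F₀^{E₀} = MC₀`), and `MC₀ ∩ MC₁ = MC₀ ∩ F₁^{PW₀}` is C1's one-sided canonical pivot.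
[cite: Gordon1999HodgeAVSurvey, §3 Theorem (proof)] [cite: Serre1977, §3.3 and §7 Ex. 7.2] -/
theorem span_coeff_inf_eq_span_stabOrbitSum_self_inf (Φ : ∀ i, Set (E i)) (i₀ i₁ : I) :
    Submodule.span ℚ (Set.range fun x : E i₀ => fun g : G => antiVec (Φ i₀) g x) ⊓
        Submodule.span ℚ (Set.range fun x : E i₁ => fun g : G => antiVec (Φ i₁) g x) =
      Submodule.span ℚ (Set.range fun x₀ : E i₀ => fun g : G =>
          ∑ x ∈ Finset.univ.filter (fun x : E i₀ => ∃ n : G, (∀ y : E i₀, n • y = y) ∧ n • x₀ = x),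
            antiVec (Φ i₀) g x) ⊓
        Submodule.span ℚ (Set.range fun x₁ : E i₁ => fun g : G =>
          ∑ x ∈ Finset.univ.filter (fun x : E i₁ => ∃ n : G, (∀ y : E i₀, n • y = y) ∧ n • x₁ = x),
            antiVec (Φ i₁) g x) := by
  rw [span_stabOrbitSum_self_eq_span_coeff (Φ i₀), inf_comm,
    span_coeff_inf_eq_span_stabOrbitSum_inf_span_coeff Φ i₁ i₀, inf_comm]

end TwoSlots

/-! ### §3 On an absorbed level: exact defect, additivity, bound, and the type-free tower criteria -/

section Absorbed

variable {I : Type u} {E : I → Type v} [∀ i, MulAction G (E i)] [Fintype I] [∀ i, Fintype (E i)]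
  [∀ i, Nonempty (E i)] {W : Type*} [MulAction G W] {W' : Type*} [MulAction G W']

/-- **THE EXACT DEFECT ON AN ABSORBED LEVEL: `rank Φ₀ + rank Φ₁ = rank(Φ₀, Φ₁) + 1 + dim(F₀^W ∩ F₁^W)`**, i.e.
**`dim Hg(A₀) + dim Hg(A₁) − dim Hg(A₀ × A₁) = dim(F₀^W ∩ F₁^W)`**, whenever `W` is absorbed (§2: `E₀`, and then every
`W'` reached by movers).  The further up the tower, the coarser the orbits and the smaller the ambient computation.
[cite: Gordon1999HodgeAVSurvey, §3 Theorem and 7.5–7.7] [cite: Deligne1982HodgeCycles, I.5 (p. 62)] -/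
theorem typeRank_add_typeRank_eq_add_finrank_of_absorbed {ρ : G} {Φ : ∀ i, Set (E i)}
    (h : ∀ i, IsCMTypeWith ρ (Φ i)) {i₀ i₁ : I} (hI : ∀ j, j = i₀ ∨ j = i₁) (h01 : i₀ ≠ i₁)
    (habs : Submodule.span ℚ (Set.range fun x : E i₀ => fun g : G => antiVec (Φ i₀) g x) ⊓
        Submodule.span ℚ (Set.range fun x : E i₁ => fun g : G => antiVec (Φ i₁) g x) =
      Submodule.span ℚ (Set.range fun x₀ : E i₀ => fun g : G =>
          ∑ x ∈ Finset.univ.filter (fun x : E i₀ => ∃ n : G, (∀ y : W, n • y = y) ∧ n • x₀ = x),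
            antiVec (Φ i₀) g x) ⊓
        Submodule.span ℚ (Set.range fun x₁ : E i₁ => fun g : G =>
          ∑ x ∈ Finset.univ.filter (fun x : E i₁ => ∃ n : G, (∀ y : W, n • y = y) ∧ n • x₁ = x),
            antiVec (Φ i₁) g x)) :
    typeRank G (Φ i₀) + typeRank G (Φ i₁) = typeRank G (sigmaType Φ) + 1 +
      Module.finrank ℚ (Submodule.span ℚ (Set.range fun x₀ : E i₀ => fun g : G =>
            ∑ x ∈ Finset.univ.filter (fun x : E i₀ => ∃ n : G, (∀ y : W, n • y = y) ∧ n • x₀ = x),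
              antiVec (Φ i₀) g x) ⊓
          Submodule.span ℚ (Set.range fun x₁ : E i₁ => fun g : G =>
            ∑ x ∈ Finset.univ.filter (fun x : E i₁ => ∃ n : G, (∀ y : W, n • y = y) ∧ n • x₁ = x),
              antiVec (Φ i₁) g x) : Submodule ℚ (G → ℚ)) := by
  rw [typeRank_add_typeRank_eq_of_pair h hI h01, habs]

/-- **`Hg(A₀ × A₁) = Hg(A₀) × Hg(A₁)` IFF `F₀^W ∩ F₁^W = 0`** on an absorbed level `W`.
[cite: Gordon1999HodgeAVSurvey, §3 Theorem and 7.5–7.7] -/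
theorem typeRank_sigmaType_add_card_eq_iff_of_absorbed {ρ : G} {Φ : ∀ i, Set (E i)}
    (h : ∀ i, IsCMTypeWith ρ (Φ i)) {i₀ i₁ : I} (hI : ∀ j, j = i₀ ∨ j = i₁) (h01 : i₀ ≠ i₁)
    (habs : Submodule.span ℚ (Set.range fun x : E i₀ => fun g : G => antiVec (Φ i₀) g x) ⊓
        Submodule.span ℚ (Set.range fun x : E i₁ => fun g : G => antiVec (Φ i₁) g x) =
      Submodule.span ℚ (Set.range fun x₀ : E i₀ => fun g : G =>
          ∑ x ∈ Finset.univ.filter (fun x : E i₀ => ∃ n : G, (∀ y : W, n • y = y) ∧ n • x₀ = x),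
            antiVec (Φ i₀) g x) ⊓
        Submodule.span ℚ (Set.range fun x₁ : E i₁ => fun g : G =>
          ∑ x ∈ Finset.univ.filter (fun x : E i₁ => ∃ n : G, (∀ y : W, n • y = y) ∧ n • x₁ = x),
            antiVec (Φ i₁) g x)) :
    typeRank G (sigmaType Φ) + Fintype.card I = (∑ i, typeRank G (Φ i)) + 1 ↔
      Submodule.span ℚ (Set.range fun x₀ : E i₀ => fun g : G =>
            ∑ x ∈ Finset.univ.filter (fun x : E i₀ => ∃ n : G, (∀ y : W, n • y = y) ∧ n • x₀ = x),
              antiVec (Φ i₀) g x) ⊓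
          Submodule.span ℚ (Set.range fun x₁ : E i₁ => fun g : G =>
            ∑ x ∈ Finset.univ.filter (fun x : E i₁ => ∃ n : G, (∀ y : W, n • y = y) ∧ n • x₁ = x),
              antiVec (Φ i₁) g x) = (⊥ : Submodule ℚ (G → ℚ)) := by
  rw [typeRank_sigmaType_add_card_eq_iff_inf_eq_bot_of_pair h hI h01, habs]

/-- **One slot suffices on an absorbed level**: if every `S_W`-orbit on `E₀` is `ρ`-stable then `F₀^W = 0` and the
pair is additive. [cite: Gordon1999HodgeAVSurvey, §3 Theorem (proof) and 7.5–7.7] [cite: Shimura1998, §18.1] -/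
theorem typeRank_sigmaType_add_card_eq_of_absorbed_of_rho_stable {ρ : G} {Φ : ∀ i, Set (E i)}
    (h : ∀ i, IsCMTypeWith ρ (Φ i)) {i₀ i₁ : I} (hI : ∀ j, j = i₀ ∨ j = i₁) (h01 : i₀ ≠ i₁)
    (habs : Submodule.span ℚ (Set.range fun x : E i₀ => fun g : G => antiVec (Φ i₀) g x) ⊓
        Submodule.span ℚ (Set.range fun x : E i₁ => fun g : G => antiVec (Φ i₁) g x) =
      Submodule.span ℚ (Set.range fun x₀ : E i₀ => fun g : G =>
          ∑ x ∈ Finset.univ.filter (fun x : E i₀ => ∃ n : G, (∀ y : W, n • y = y) ∧ n • x₀ = x),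
            antiVec (Φ i₀) g x) ⊓
        Submodule.span ℚ (Set.range fun x₁ : E i₁ => fun g : G =>
          ∑ x ∈ Finset.univ.filter (fun x : E i₁ => ∃ n : G, (∀ y : W, n • y = y) ∧ n • x₁ = x),
            antiVec (Φ i₁) g x))
    (hρ : ∀ x₀ : E i₀, ∃ n : G, (∀ y : W, n • y = y) ∧ n • x₀ = ρ • x₀) :
    typeRank G (sigmaType Φ) + Fintype.card I = (∑ i, typeRank G (Φ i)) + 1 := by
  rw [typeRank_sigmaType_add_card_eq_iff_of_absorbed h hI h01 habs,
    span_stabOrbitSum_eq_bot_of_stabOrbit_rho_stable (h i₀) hρ, bot_inf_eq]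

/-- … or every `S_W`-orbit on `E₁` is `ρ`-stable. [cite: Gordon1999HodgeAVSurvey, §3 Theorem (proof) and 7.5–7.7] -/
theorem typeRank_sigmaType_add_card_eq_of_absorbed_of_rho_stable' {ρ : G} {Φ : ∀ i, Set (E i)}
    (h : ∀ i, IsCMTypeWith ρ (Φ i)) {i₀ i₁ : I} (hI : ∀ j, j = i₀ ∨ j = i₁) (h01 : i₀ ≠ i₁)
    (habs : Submodule.span ℚ (Set.range fun x : E i₀ => fun g : G => antiVec (Φ i₀) g x) ⊓
        Submodule.span ℚ (Set.range fun x : E i₁ => fun g : G => antiVec (Φ i₁) g x) =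
      Submodule.span ℚ (Set.range fun x₀ : E i₀ => fun g : G =>
          ∑ x ∈ Finset.univ.filter (fun x : E i₀ => ∃ n : G, (∀ y : W, n • y = y) ∧ n • x₀ = x),
            antiVec (Φ i₀) g x) ⊓
        Submodule.span ℚ (Set.range fun x₁ : E i₁ => fun g : G =>
          ∑ x ∈ Finset.univ.filter (fun x : E i₁ => ∃ n : G, (∀ y : W, n • y = y) ∧ n • x₁ = x),
            antiVec (Φ i₁) g x))
    (hρ : ∀ x₁ : E i₁, ∃ n : G, (∀ y : W, n • y = y) ∧ n • x₁ = ρ • x₁) :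
    typeRank G (sigmaType Φ) + Fintype.card I = (∑ i, typeRank G (Φ i)) + 1 := by
  rw [typeRank_sigmaType_add_card_eq_iff_of_absorbed h hI h01 habs,
    span_stabOrbitSum_eq_bot_of_stabOrbit_rho_stable (h i₁) hρ, inf_bot_eq]

/-- **THE TWO-STEP TYPE-FREE CRITERION.**  Let `W` be a `G`-set whose pointwise stabiliser `S_W` moves every point of
`E₁` inside its `PW₀`-orbit (so `W` is absorbed: base + one step driven by slot `1`), and suppose every `S_W`-orbit on
`E₀` is `ρ`-stable.  Then **`Hg(A₀ × A₁) = Hg(A₀) × Hg(A₁)` for EVERY pair of CM types** (for `ρ`).  C1's criterion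
(`typeRank_sigmaType_add_card_eq_of_stabOrbit_rho_stable`) is the case `W = E₁`; here the orbits on `E₀` may be much
coarser (for `Aut(ℂ)`: the classes for the Galois closure of the trace `K₁ ∩ L₀` instead of those for `L₁`, file A2).
[cite: Gordon1999HodgeAVSurvey, §3 Theorem (proof) and 7.5–7.7] [cite: Shimura1998, §8.3 and §18.1] -/
theorem typeRank_sigmaType_add_card_eq_of_movers_of_rho_stable {ρ : G} {Φ : ∀ i, Set (E i)}
    (h : ∀ i, IsCMTypeWith ρ (Φ i)) {i₀ i₁ : I} (hI : ∀ j, j = i₀ ∨ j = i₁) (h01 : i₀ ≠ i₁)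
    (hW : ∀ m : G, (∀ y : W, m • y = y) → ∀ x : E i₁, ∃ n : G, (∀ y : E i₀, n • y = y) ∧ n • x = m • x)
    (hρ : ∀ x₀ : E i₀, ∃ n : G, (∀ y : W, n • y = y) ∧ n • x₀ = ρ • x₀) :
    typeRank G (sigmaType Φ) + Fintype.card I = (∑ i, typeRank G (Φ i)) + 1 :=
  typeRank_sigmaType_add_card_eq_of_absorbed_of_rho_stable h hI h01
    (span_coeff_inf_eq_of_absorbed_of_movers' Φ i₀ i₁
      (span_coeff_inf_eq_span_stabOrbitSum_self_inf Φ i₀ i₁).le hW) hρ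

/-- **THE THREE-STEP TYPE-FREE CRITERION.**  `W` as in the two-step criterion (its pointwise stabiliser moves the points
of `E₁` inside their `PW₀`-orbits); `W'` a `G`-set whose pointwise stabiliser moves the points of `E₀` inside their
`S_W`-orbits; if every `S_{W'}`-orbit on `E₁` is `ρ`-stable, then `Hg(A₀ × A₁) = Hg(A₀) × Hg(A₁)` for every pair of CM
types.  (Further steps: alternate `span_coeff_inf_eq_of_absorbed_of_movers` / `…'`.)
[cite: Gordon1999HodgeAVSurvey, §3 Theorem (proof) and 7.5–7.7] [cite: Shimura1998, §8.3 and §18.1] -/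
theorem typeRank_sigmaType_add_card_eq_of_movers_of_movers_of_rho_stable {ρ : G} {Φ : ∀ i, Set (E i)}
    (h : ∀ i, IsCMTypeWith ρ (Φ i)) {i₀ i₁ : I} (hI : ∀ j, j = i₀ ∨ j = i₁) (h01 : i₀ ≠ i₁)
    (hW : ∀ m : G, (∀ y : W, m • y = y) → ∀ x : E i₁, ∃ n : G, (∀ y : E i₀, n • y = y) ∧ n • x = m • x)
    (hW' : ∀ m : G, (∀ y' : W', m • y' = y') → ∀ x : E i₀, ∃ n : G, (∀ y : W, n • y = y) ∧ n • x = m • x)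
    (hρ : ∀ x₁ : E i₁, ∃ n : G, (∀ y' : W', n • y' = y') ∧ n • x₁ = ρ • x₁) :
    typeRank G (sigmaType Φ) + Fintype.card I = (∑ i, typeRank G (Φ i)) + 1 :=
  typeRank_sigmaType_add_card_eq_of_absorbed_of_rho_stable' h hI h01
    (span_coeff_inf_eq_of_absorbed_of_movers Φ i₀ i₁
      (span_coeff_inf_eq_of_absorbed_of_movers' Φ i₀ i₁
        (span_coeff_inf_eq_span_stabOrbitSum_self_inf Φ i₀ i₁).le hW).le hW') hρ

end Absorbed

end Summit.HodgeConjecture.CorCM.IrrOdd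

end
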